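/-
Copyright (c) 2026 the pub-hodgecm-mathlib formalisation cell (harness21).  Prover seat hodgecm-mathlib-LH4-p04 (g2), req620 Track A «(D-RAM) FOUR-FRAME» squad
(MS ROAD A, STAGE B brick B3₂ «TYPE-2 STRATA TABLE» — part 5: the dual-frame SANDWICH and the HNF Gram values at a vertex of ANY type).  2026-09-04.
-/
import Summits.HodgeConjecture.HodgeConjecture.Theorems.F0P3cDyRamDiagonalHNFDualFrameValues   -- ★ part 1 (this seat): `hnf_gram_apply_one_one`, `hnf_gram_apply_zero_zero`, `hnf_gram_det`; brings ★ TorusDefs, ★ (3c-i) (hence ★ p855301 `dualLatt_diagonal_latt_hnf`, `v_dualFrame_apply`), ★ HNF, ★ `vertexTriple_of_latt_eq`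
import Literature.NumberTheory.Automorphic.UnitaryLatticeTreeTypes                           -- ★ `le_dualLatt_of_isVertexLattice`, `scaleLattice_dualLatt_le_of_isVertexLattice` (`M ≤ M^♯`, `ϖM^♯ ≤ M`)
import HarnessLib

/-!
# Crux `H413`, line LH4 «(D-RAM) FOUR-FRAME» road — unit U3_Laws (iii), MS ROAD A, STAGE B brick B3₂ (part 5): THE DUAL-FRAME SANDWICH `|ϖ|·R_i ≤ |D_i| ≤ R_i` and the HNF
# Gram values at a vertex lattice `(1 0 0; x ϖ^b 0; y z ϖ^c)·𝒪³` of ANY type `d` for a diagonal form `diag(D)`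

Cell `hodgecm-mathlib` (D-0151), FLOOR 0, crux item H413 = `stmt-HodgeConjecture-24833`, route of record `HCCMUnconditional`; squad F0∕P3c∕LH4 (req618∕req620); registered stub served:
`F0P3cDyRamFourFrameU3.stub_U3_stableModelSum` (MS).  THEOREMS ONLY (no `def`, no instance, no notation, no `sorry`, default heartbeats); lane
`--supports stmt-HodgeConjecture-24833 --as helper` (count-neutral).  STAGE B type-2 twin (LH4-p10 (g2) `MEMO-stableLaw-finite.v2.1-type2` §T2.0∕§T2.1, B10₂ skeleton; this seat's
census `F0/P3c/LH4/LH4-p04/g2/CENSUS-B3type2.v1`): the type-2 strata table sieves on the facts packaged here exactly as the type-0 table (★ part 2) sieved on ★ part 1.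

THE MATHEMATICS (MEMO v2.1 §T2.0).  `N = latt V` (HNF, `x y z ∈ 𝒪`, normalised) is a vertex lattice of type `d` for `diag(D)` (`D_i ≠ 0`): `N ≤ N^♯` and `ϖN^♯ ≤ N` (★ `UnitaryLatticeTreeTypes`),
and `N^♯ = latt U_D` for the explicit dual frame `U_D` of ★ p855301 (`dualLatt_diagonal_latt_hnf`), whose `i`-th row is `(D_i)⁻¹ ×` the `i`-th row of `U_1 = ((σV)ᵀ)⁻¹`.  Reading the
two inclusions coordinatewise (normalisation: `pr_i(N) = 𝒪`): a vector of `N` with a unit `i`-th coordinate lies in `latt U_D`, so `1 ≤ max_j |(U_D)_{ij}| = R_i∕|D_i|` (★ row ideal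
p855324); and `ϖ` times each column of `U_D` lies in `N ⊆ 𝒪³`, so `|ϖ|·|(U_1)_{ij}|∕|D_i| ≤ 1` — together **`|ϖ|·R_i ≤ |D_i| ≤ R_i`** with `R₂ = exp c`, `R₁ = max(exp b, |z|exp(b+c))`,
`R₀ = max(1, |x|exp b, |xz − yϖ^b|exp(b+c))` (type `0`: equality, ★ part 1; type `2`: `|D_i| = exp(2⌊a_i∕2⌋)` once `|D_i|` is an even power).  And in the HNF basis the Gram matrix
`G = (σV)ᵀ diag(D) V` is integral with `|det G| = |ϖ|^d` (★ `vertexTriple_of_latt_eq`): `|G₁₁|, |G₀₁|, |G₀₀| ≤ 1`, `|σ(ϖ^bϖ^c)·D₀D₁D₂·ϖ^bϖ^c| = |ϖ|^d`.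

WHAT IS PROVED.  §1 `v_dualFrameOne_*` (valuations of the six entries of `U_1`), `hnf_gram_apply_zero_one`.  §2 HEAD `dualFrame_sandwich` (any type `d`): the lower bounds
`|ϖ|·(entry) ≤ |D_i|` for all six entries and the attained upper bound per row as a disjunction.  §3 `gram_values_of_type` (any `d`): `|G₁₁| ≤ 1 ∧ |G₀₁| ≤ 1 ∧ |G₀₀| ≤ 1 ∧ |det| = |ϖ|^d`.
HONEST LABEL.  Count-neutral (`--supports`); nothing printed is asserted; (MS) stays a PROVER TARGET (empirical census law — MEMO v2∕v2.1 is its paper proof); `HC_CM` is proved only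
modulo the 7 printed citations (2 remaining named inputs: hLiu418 = `stmt-HodgeConjecture-24832`, h413 = `stmt-HodgeConjecture-24833`) until rung 0 closes.

## References
* [Jacobowitz1962] R. Jacobowitz, *Hermitian forms over local fields*, Amer. J. Math. 84 (1962), §4 (dual bases), §7–§8 (unimodular and `𝔭`-modular lattices: `𝔭M^♯ ⊆ M ⊆ M^♯`).
* [Kottwitz1986BaseChangeUnits] R. E. Kottwitz, *Base change for unit elements of Hecke algebras*, Compositio Math. 60 (1986), §1 pp. 240–241 (fixed lattices counted by position).
* [Serre1980Trees] J.-P. Serre, *Trees*, Springer (1980), Ch. II §1.1 (lattices, Hermite normal forms, coordinate axes).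
-/

set_option autoImplicit false

noncomputable section

namespace Summit.HodgeConjecture.HodgeConjecture.Cruxes.H413.F0P3cDyRamDiagonalHNFDualFrameValuesTypeTwo

open Matrix
open Literature.NumberTheory.Automorphic Literature.NumberTheory.Automorphic.HermitianLattice
open Literature.NumberTheory.Automorphic.UnitaryLatticeTree
open Summit.HodgeConjecture.HodgeConjecture.Cruxes.H413.F0P3cDyRamDiagonalTorusDefs
open Summit.HodgeConjecture.HodgeConjecture.Cruxes.H413.F0P3cDyRamDiagonalHNFDual
open Summit.HodgeConjecture.HodgeConjecture.Cruxes.H413.F0P3cDyRamDiagonalDualisableExponents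
open Summit.HodgeConjecture.HodgeConjecture.Cruxes.H413.F0P3cDyRamLattRowIdeal
open Summit.HodgeConjecture.HodgeConjecture.Cruxes.H413.F0P3cDyRamDiagonalStableLatticeHNF
open Summit.HodgeConjecture.HodgeConjecture.Cruxes.H413.F0P3cDyRamDiagonalHNFDualFrameValues
open scoped Valued WithZero Matrix MatrixGroups

variable {K : Type*} [Field K] [Valued K ℤᵐ⁰]

/-! ## §1  Valuations of the entries of the dual frame `U_1`; the Gram entry `(0,1)` -/

/-- `|(σϖ^n)⁻¹| = exp n`. [cite: Serre1980Trees, II §1.1] -/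
theorem v_inv_map_pow {σ : K →+* K} (hvσ : ∀ a, Valued.v (σ a) = Valued.v a) {ϖ : K} (hϖ : Valued.v ϖ = WithZero.exp (-1 : ℤ)) (n : ℕ) :
    Valued.v ((σ ϖ ^ n)⁻¹) = WithZero.exp (n : ℤ) := by
  rw [map_inv₀, map_pow, hvσ, hϖ, ← WithZero.exp_nsmul, ← WithZero.exp_neg]
  congr 1
  simp

/-- `|−σz·(σϖ^b)⁻¹·(σϖ^c)⁻¹| = |z|·exp(b+c)`. [cite: Jacobowitz1962, §4] -/
theorem v_dualFrameOne_one_two {σ : K →+* K} (hvσ : ∀ a, Valued.v (σ a) = Valued.v a) {ϖ : K} (hϖ : Valued.v ϖ = WithZero.exp (-1 : ℤ)) (b c : ℕ) (z : K) :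
    Valued.v (-σ z * (σ ϖ ^ b)⁻¹ * (σ ϖ ^ c)⁻¹) = Valued.v z * WithZero.exp ((b : ℤ) + c) := by
  rw [map_mul, map_mul, Valuation.map_neg, hvσ, v_inv_map_pow hvσ hϖ, v_inv_map_pow hvσ hϖ, WithZero.exp_add, mul_assoc]

/-- `|−σx·(σϖ^b)⁻¹| = |x|·exp b`. [cite: Jacobowitz1962, §4] -/
theorem v_dualFrameOne_zero_one {σ : K →+* K} (hvσ : ∀ a, Valued.v (σ a) = Valued.v a) {ϖ : K} (hϖ : Valued.v ϖ = WithZero.exp (-1 : ℤ)) (b : ℕ) (x : K) :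
    Valued.v (-σ x * (σ ϖ ^ b)⁻¹) = Valued.v x * WithZero.exp (b : ℤ) := by
  rw [map_mul, Valuation.map_neg, hvσ, v_inv_map_pow hvσ hϖ]

/-- `|(σxσz(σϖ^b)⁻¹ − σy)·(σϖ^c)⁻¹| = |xz − yϖ^b|·exp(b+c)`. [cite: Jacobowitz1962, §4] -/
theorem v_dualFrameOne_zero_two {σ : K →+* K} (hvσ : ∀ a, Valued.v (σ a) = Valued.v a) {ϖ : K} (hϖ : Valued.v ϖ = WithZero.exp (-1 : ℤ)) (b c : ℕ) (x y z : K) :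
    Valued.v ((σ x * σ z * (σ ϖ ^ b)⁻¹ - σ y) * (σ ϖ ^ c)⁻¹) = Valued.v (x * z - y * ϖ ^ b) * WithZero.exp ((b : ℤ) + c) := by
  have hϖ0 : ϖ ≠ 0 := (Valuation.ne_zero_iff Valued.v).1 (by rw [hϖ]; exact WithZero.exp_ne_zero)
  have h1 : σ x * σ z * (σ ϖ ^ b)⁻¹ - σ y = σ ((x * z - y * ϖ ^ b) * (ϖ ^ b)⁻¹) := by
    rw [sub_mul, mul_inv_cancel_right₀ (pow_ne_zero _ hϖ0), map_sub, map_mul, map_mul, map_inv₀, map_pow]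
  have h2 : Valued.v ((ϖ ^ b)⁻¹) = WithZero.exp (b : ℤ) := by
    rw [map_inv₀, map_pow, hϖ, ← WithZero.exp_nsmul, ← WithZero.exp_neg]; congr 1; simp
  rw [map_mul, h1, hvσ, map_mul, h2, v_inv_map_pow hvσ hϖ, mul_assoc, ← WithZero.exp_add]

omit [Valued K ℤᵐ⁰] in
/-- Entry `(0,1)` of `(σV)ᵀ·diag(D)·V` for the HNF model `V = [[1,0,0],[x,p,0],[y,z,r]]`: `σx·D₁·p + σy·D₂·z`. [cite: Jacobowitz1962, §4] -/
theorem hnf_gram_apply_zero_one (σ : K →+* K) (D : Fin 3 → K) (x y z p r : K) :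
    (((Matrix.of ![![1, 0, 0], ![x, p, 0], ![y, z, r]]).map σ)ᵀ * Matrix.diagonal D * Matrix.of ![![1, 0, 0], ![x, p, 0], ![y, z, r]]) 0 1 =
      σ x * D 1 * p + σ y * D 2 * z := by
  simp [Matrix.mul_apply, Fin.sum_univ_three]

/-! ## §2  HEAD — the dual-frame sandwich at a vertex of any type -/

/-- **THE DUAL-FRAME SANDWICH `|ϖ|·R_i ≤ |D_i| ≤ R_i`** (any vertex type `d`).  Let `N = latt (1 0 0; x ϖ^b 0; y z ϖ^c)` (`x y z ∈ 𝒪`, normalised) be a type-`d` vertex lattice of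
`diag(D)` (`D_i ≠ 0`, `σ` valuation-preserving, `|ϖ| = exp(−1)`).  LOWER bounds (from `ϖN^♯ ≤ N ≤ 𝒪³` on the columns of the dual frame `U_D`, ★ p855301): `|ϖ|·exp c ≤ |D₂|`;
`|ϖ|·exp b ≤ |D₁|`, `|ϖ|·|z|·exp(b+c) ≤ |D₁|`; `|ϖ| ≤ |D₀|`, `|ϖ|·|x|·exp b ≤ |D₀|`, `|ϖ|·|xz − yϖ^b|·exp(b+c) ≤ |D₀|`.  UPPER bounds (from `N ≤ N^♯` on a vector of `N` with unit
`i`-th coordinate, ★ row ideal p855324): `|D₂| ≤ exp c`; `|D₁| ≤ exp b ∨ |D₁| ≤ |z|·exp(b+c)`; `|D₀| ≤ 1 ∨ |D₀| ≤ |x|·exp b ∨ |D₀| ≤ |xz − yϖ^b|·exp(b+c)`.  (Type `0`: equalities, ★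
part 1; type `2`: `|D_i| = exp(2⌊a_i∕2⌋)` once `|D_i|` is an even power, MEMO v2.1 §T2.0.) [cite: Jacobowitz1962, §4, §7–§8] [cite: Serre1980Trees, II §1.1]
[cite: Kottwitz1986BaseChangeUnits, §1 pp. 240–241] -/
theorem dualFrame_sandwich {σ : K →+* K} (hvσ : ∀ a, Valued.v (σ a) = Valued.v a) {ϖ : K} (hϖ : Valued.v ϖ = WithZero.exp (-1 : ℤ))
    {D : Fin 3 → K} (hD0 : ∀ i, D i ≠ 0) (b c : ℕ) {x y z : K}
    (hn : IsNormalisedLattice (latt (Matrix.of ![![1, 0, 0], ![x, ϖ ^ b, 0], ![y, z, ϖ ^ c]]))) {d : ℕ}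
    (hM : IsVertexLattice σ ϖ (Matrix.diagonal D) d (latt (Matrix.of ![![1, 0, 0], ![x, ϖ ^ b, 0], ![y, z, ϖ ^ c]]))) :
    (Valued.v ϖ * WithZero.exp (c : ℤ) ≤ Valued.v (D 2) ∧ Valued.v (D 2) ≤ WithZero.exp (c : ℤ)) ∧
    (Valued.v ϖ * WithZero.exp (b : ℤ) ≤ Valued.v (D 1) ∧ Valued.v ϖ * (Valued.v z * WithZero.exp ((b : ℤ) + c)) ≤ Valued.v (D 1) ∧
      (Valued.v (D 1) ≤ WithZero.exp (b : ℤ) ∨ Valued.v (D 1) ≤ Valued.v z * WithZero.exp ((b : ℤ) + c))) ∧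
    (Valued.v ϖ ≤ Valued.v (D 0) ∧ Valued.v ϖ * (Valued.v x * WithZero.exp (b : ℤ)) ≤ Valued.v (D 0) ∧
      Valued.v ϖ * (Valued.v (x * z - y * ϖ ^ b) * WithZero.exp ((b : ℤ) + c)) ≤ Valued.v (D 0) ∧
      (Valued.v (D 0) ≤ 1 ∨ Valued.v (D 0) ≤ Valued.v x * WithZero.exp (b : ℤ) ∨
        Valued.v (D 0) ≤ Valued.v (x * z - y * ϖ ^ b) * WithZero.exp ((b : ℤ) + c))) := by
  have hvD0 : ∀ i, Valued.v (D i) ≠ 0 := fun i => (Valuation.ne_zero_iff _).2 (hD0 i)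
  have hvDpos : ∀ i, 0 < Valued.v (D i) := fun i => (Valuation.pos_iff _).2 (hD0 i)
  have hϖ0 : ϖ ≠ 0 := (Valuation.ne_zero_iff Valued.v).1 (by rw [hϖ]; exact WithZero.exp_ne_zero)
  have hH : IsUnit (Matrix.diagonal D).det := by
    rw [Matrix.det_diagonal]; exact (Finset.prod_ne_zero_iff.2 fun i _ => hD0 i).isUnit
  -- `N^♯ = latt U_D`; `N ≤ N^♯`; `ϖN^♯ ≤ N`
  have hL := dualLatt_diagonal_latt_hnf σ hvσ hϖ0 hD0 x y z b c
  set U : Matrix (Fin 3) (Fin 3) K := !![(D 0)⁻¹, -σ x * (σ ϖ ^ b)⁻¹ * (D 0)⁻¹, (σ x * σ z * (σ ϖ ^ b)⁻¹ - σ y) * (σ ϖ ^ c)⁻¹ * (D 0)⁻¹;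
      0, (σ ϖ ^ b)⁻¹ * (D 1)⁻¹, -σ z * (σ ϖ ^ b)⁻¹ * (σ ϖ ^ c)⁻¹ * (D 1)⁻¹;
      0, 0, (σ ϖ ^ c)⁻¹ * (D 2)⁻¹] with hU
  have hsub : latt (Matrix.of ![![1, 0, 0], ![x, ϖ ^ b, 0], ![y, z, ϖ ^ c]] : Matrix (Fin 3) (Fin 3) K) ≤ latt U := by
    rw [hU, ← hL]; exact le_dualLatt_of_isVertexLattice hvσ hM
  have hsup : scaleLattice ϖ (latt U) ≤ latt (Matrix.of ![![1, 0, 0], ![x, ϖ ^ b, 0], ![y, z, ϖ ^ c]] : Matrix (Fin 3) (Fin 3) K) := by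
    rw [hU, ← hL]; exact scaleLattice_dualLatt_le_of_isVertexLattice hvσ hH hM
  -- LOWER: `|ϖ|·|U_{ij}| ≤ 1` for all `i, j` (the column `U·e_j`, times `ϖ`, lies in `N ⊆ 𝒪³`)
  have hlow : ∀ i j : Fin 3, Valued.v ϖ * Valued.v (U i j) ≤ 1 := by
    intro i j
    have hmem : ϖ • U.mulVec (Pi.single j 1) ∈ latt (Matrix.of ![![1, 0, 0], ![x, ϖ ^ b, 0], ![y, z, ϖ ^ c]] : Matrix (Fin 3) (Fin 3) K) :=
      hsup (Submodule.mem_map.2 ⟨_, mulVec_single_mem_latt U j, rfl⟩)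
    have h := (hn i).1 _ hmem
    rwa [Pi.smul_apply, smul_eq_mul, Matrix.mulVec_single_one, Matrix.col_apply, map_mul] at h
  -- UPPER: a vector of `N` with `|n_i| = 1` lies in `latt U`, so `1 ≤ |U_{ij}|` for some `j`
  have hup : ∀ i : Fin 3, (1 : ℤᵐ⁰) ≤ Valued.v (U i 0) ∨ (1 : ℤᵐ⁰) ≤ Valued.v (U i 1) ∨ (1 : ℤᵐ⁰) ≤ Valued.v (U i 2) := by
    intro i
    obtain ⟨n, hnM, hni⟩ := (hn i).2
    have h := v_apply_le_sup_of_mem_latt' U i (hsub hnM)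
    obtain ⟨j, -, hj⟩ := Finset.exists_mem_eq_sup' Finset.univ_nonempty (fun j => Valued.v (U i j))
    rw [hni, hj] at h
    fin_cases j
    · exact Or.inl h
    · exact Or.inr (Or.inl h)
    · exact Or.inr (Or.inr h)
  -- the entries of `U`
  have e00 : U 0 0 = (D 0)⁻¹ := rfl
  have e01 : U 0 1 = -σ x * (σ ϖ ^ b)⁻¹ * (D 0)⁻¹ := rfl
  have e02 : U 0 2 = (σ x * σ z * (σ ϖ ^ b)⁻¹ - σ y) * (σ ϖ ^ c)⁻¹ * (D 0)⁻¹ := rfl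
  have e10 : U 1 0 = 0 := rfl
  have e11 : U 1 1 = (σ ϖ ^ b)⁻¹ * (D 1)⁻¹ := rfl
  have e12 : U 1 2 = -σ z * (σ ϖ ^ b)⁻¹ * (σ ϖ ^ c)⁻¹ * (D 1)⁻¹ := rfl
  have e20 : U 2 0 = 0 := rfl
  have e21 : U 2 1 = 0 := rfl
  have e22 : U 2 2 = (σ ϖ ^ c)⁻¹ * (D 2)⁻¹ := rfl
  -- lower-bound extraction: `|ϖ|·E·|D_i|⁻¹ ≤ 1 → |ϖ|·E ≤ |D_i|`
  have hlo : ∀ (i : Fin 3) (E : ℤᵐ⁰), Valued.v ϖ * (E * (Valued.v (D i))⁻¹) ≤ 1 → Valued.v ϖ * E ≤ Valued.v (D i) := fun i E h => by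
    rwa [← mul_assoc, mul_inv_le_iff₀ (hvDpos i), one_mul] at h
  -- upper-bound extraction: `1 ≤ E·|D_i|⁻¹ → |D_i| ≤ E`
  have hhi : ∀ (i : Fin 3) (E : ℤᵐ⁰), 1 ≤ E * (Valued.v (D i))⁻¹ → Valued.v (D i) ≤ E := fun i E h => by
    rwa [le_mul_inv_iff₀ (hvDpos i), one_mul] at h
  refine ⟨⟨?_, ?_⟩, ⟨?_, ?_, ?_⟩, ⟨?_, ?_, ?_, ?_⟩⟩
  · have h := hlow 2 2
    rw [e22, map_mul, v_inv_map_pow hvσ hϖ, map_inv₀] at h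
    exact hlo 2 _ h
  · rcases hup 2 with hj | hj | hj
    · rw [e20, map_zero] at hj; exact absurd hj (not_le_of_gt zero_lt_one)
    · rw [e21, map_zero] at hj; exact absurd hj (not_le_of_gt zero_lt_one)
    · rw [e22, map_mul, v_inv_map_pow hvσ hϖ, map_inv₀] at hj; exact hhi 2 _ hj
  · have h := hlow 1 1
    rw [e11, map_mul, v_inv_map_pow hvσ hϖ, map_inv₀] at h
    exact hlo 1 _ h
  · have h := hlow 1 2
    rw [e12, map_mul, v_dualFrameOne_one_two hvσ hϖ, map_inv₀] at h
    exact hlo 1 _ h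
  · rcases hup 1 with hj | hj | hj
    · rw [e10, map_zero] at hj; exact absurd hj (not_le_of_gt zero_lt_one)
    · rw [e11, map_mul, v_inv_map_pow hvσ hϖ, map_inv₀] at hj; exact Or.inl (hhi 1 _ hj)
    · rw [e12, map_mul, v_dualFrameOne_one_two hvσ hϖ, map_inv₀] at hj; exact Or.inr (hhi 1 _ hj)
  · have h := hlow 0 0
    rw [e00, map_inv₀, mul_inv_le_iff₀ (hvDpos 0), one_mul] at h
    exact h
  · have h := hlow 0 1
    rw [e01, map_mul, v_dualFrameOne_zero_one hvσ hϖ, map_inv₀] at h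
    exact hlo 0 _ h
  · have h := hlow 0 2
    rw [e02, map_mul, v_dualFrameOne_zero_two hvσ hϖ, map_inv₀] at h
    exact hlo 0 _ h
  · rcases hup 0 with hj | hj | hj
    · rw [e00, map_inv₀] at hj
      exact Or.inl (hhi 0 1 (by rwa [one_mul]))
    · rw [e01, map_mul, v_dualFrameOne_zero_one hvσ hϖ, map_inv₀] at hj; exact Or.inr (Or.inl (hhi 0 _ hj))
    · rw [e02, map_mul, v_dualFrameOne_zero_two hvσ hϖ, map_inv₀] at hj; exact Or.inr (Or.inr (hhi 0 _ hj))


/-! ## §3  The Gram values in the HNF basis at a vertex of any type -/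

/-- **THE GRAM VALUES IN THE HNF BASIS** (any vertex type `d`): for a type-`d` vertex lattice `latt V` of `diag(D)` (`V = (1 0 0; x ϖ^b 0; y z ϖ^c)`, `ϖ ≠ 0`, `σ`
valuation-preserving), the Gram matrix `(σV)ᵀ diag(D) V` of THIS basis is integral with `|det| = |ϖ|^d` (★ `vertexTriple_of_latt_eq`); in particular
`|σ(ϖ^b)D₁ϖ^b + σz·D₂·z| ≤ 1` (entry 11), `|σx·D₁·ϖ^b + σy·D₂·z| ≤ 1` (entry 01), `|D₀ + σx·D₁·x + σy·D₂·y| ≤ 1` (entry 00) and `|σ(ϖ^bϖ^c)·(D₀D₁D₂)·(ϖ^bϖ^c)| = |ϖ|^d`.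
[cite: Jacobowitz1962, §4, §7–§8] -/
theorem gram_values_of_type {σ : K →+* K} (hvσ : ∀ a, Valued.v (σ a) = Valued.v a) {ϖ : K} (hϖ0 : ϖ ≠ 0) (D : Fin 3 → K) (b c : ℕ) (x y z : K) {d : ℕ}
    (hM : IsVertexLattice σ ϖ (Matrix.diagonal D) d (latt (Matrix.of ![![1, 0, 0], ![x, ϖ ^ b, 0], ![y, z, ϖ ^ c]]))) :
    Valued.v (σ (ϖ ^ b) * D 1 * ϖ ^ b + σ z * D 2 * z) ≤ 1 ∧ Valued.v (σ x * D 1 * ϖ ^ b + σ y * D 2 * z) ≤ 1 ∧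
      Valued.v (D 0 + σ x * D 1 * x + σ y * D 2 * y) ≤ 1 ∧ Valued.v (σ (ϖ ^ b * ϖ ^ c) * (D 0 * D 1 * D 2) * (ϖ ^ b * ϖ ^ c)) = Valued.v ϖ ^ d := by
  have hdetV : (Matrix.of ![![1, 0, 0], ![x, ϖ ^ b, 0], ![y, z, ϖ ^ c]] : Matrix (Fin 3) (Fin 3) K).det ≠ 0 := by
    rw [F0P3cDyRamDiagonalStableLatticeHNF.det_hnf]; exact mul_ne_zero (pow_ne_zero _ hϖ0) (pow_ne_zero _ hϖ0)
  obtain ⟨hint, -, hdetG⟩ := vertexTriple_of_latt_eq hvσ (g' := Matrix.GeneralLinearGroup.mkOfDetNeZero _ hdetV) hM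
  refine ⟨?_, ?_, ?_, ?_⟩
  · have h := hint 1 1
    rwa [show formCongr σ (Matrix.GeneralLinearGroup.mkOfDetNeZero _ hdetV) (Matrix.diagonal D) 1 1 = _ from
      hnf_gram_apply_one_one σ D x y z (ϖ ^ b) (ϖ ^ c)] at h
  · have h := hint 0 1
    rwa [show formCongr σ (Matrix.GeneralLinearGroup.mkOfDetNeZero _ hdetV) (Matrix.diagonal D) 0 1 = _ from
      hnf_gram_apply_zero_one σ D x y z (ϖ ^ b) (ϖ ^ c)] at h
  · have h := hint 0 0
    rwa [show formCongr σ (Matrix.GeneralLinearGroup.mkOfDetNeZero _ hdetV) (Matrix.diagonal D) 0 0 = _ from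
      hnf_gram_apply_zero_zero σ D x y z (ϖ ^ b) (ϖ ^ c)] at h
  · rwa [show (formCongr σ (Matrix.GeneralLinearGroup.mkOfDetNeZero _ hdetV) (Matrix.diagonal D)).det = _ from
      hnf_gram_det σ D x y z (ϖ ^ b) (ϖ ^ c)] at hdetG

end Summit.HodgeConjecture.HodgeConjecture.Cruxes.H413.F0P3cDyRamDiagonalHNFDualFrameValuesTypeTwo

end
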